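import Summits.HubbardSuperconductivity.HubbardSuperconductivity.Theses.ParityGapRigidity
import Literature.MathematicalPhysics.QuantumLattice.FreeFermionLowLyingLevels
import HarnessLib

/-!
# Route `ParityGapRigidity` — the `U = 0` calibration of the level-count clause (H3): it FAILS

Third of the `U = 0` calibrations of the spectral clauses of the crux `GappedWindow`
(stmt-HubbardSuperconductivity-2196), after `ParityGapRigidityZeroCouplingParityGap.lean` ((PG) false)
and `ParityGapRigidityZeroCouplingStaircase.lean` ((H4) true): the level-count clause (H3) — "some
`c > 0`, `D`, `L₀` such that for all even `L ≥ L₀` every subspace of the sector `(N_L, S^z = 0)` with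
Rayleigh quotient `≤ E₀ + c/L` has dimension `≤ D`" — is FALSE for the free torus family
`hubbardTorus 2 L 1 0` at every doping `δ ∈ (0, 1/2)`
(`Literature.MathematicalPhysics.QuantumLattice.exists_lowLying_free`: a flat column of the band
crossing the Fermi level carries `D + 1` pair excitations of energy `≤ c/L` for all large even `L`).

* `gappedWindow_levelCount_clause_fails_at_zero_coupling` — the third conjunct of
  `Theses.ParityGapRigidity.GappedWindow` with the hypothesis `0 < U` replaced by `U = 0`, verbatim
  otherwise, is false for every `δ ∈ (0, 1/2)`.

Reading.  (i) For the crux: (H3), like (PG), is a genuinely interacting clause with no free instance to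
deform from.  (ii) For the converse-LSM crux `IncommensurateRigidity` (stmt-HubbardSuperconductivity-2195),
whose hypothesis (H3) is the same text: its hypotheses correctly EXCLUDE the free Fermi gas (which has no
ODLRO), through (H3) — a necessary sanity check of the bet, now machine-checked.

Sources: Bardeen–Cooper–Schrieffer (1957) §II (Fermi seas and pair excitations). [folklore]
-/

-- the mandated namespace `Summit.<Summit>.<Problem>.Theorems` repeats `HubbardSuperconductivity`
-- (single-problem summit, D-0017), which the `dupNamespace` linter flags on every declaration
set_option linter.dupNamespace false

noncomputable section

namespace Summit.HubbardSuperconductivity.HubbardSuperconductivity.Theorems.ParityGapRigidityFree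

open Literature.MathematicalPhysics.QuantumLattice

/-- **`U = 0` calibration of the level-count clause (H3) of `GappedWindow`: it FAILS at zero coupling
on the whole doping window.** With `0 < U` replaced by `U = 0`, the third conjunct of
`Theses.ParityGapRigidity.GappedWindow` (verbatim) is false for every `δ ∈ (0, 1/2)`: for every `c > 0`,
`D`, `L₀` the free torus at some even `L ≥ L₀` has a subspace of the sector `(N_L, S^z = 0)` of
dimension `D + 1` with Rayleigh quotient `≤ E₀ + c/L` (`exists_lowLying_free`). [folklore] -/
theorem gappedWindow_levelCount_clause_fails_at_zero_coupling :
    ∀ (U δ : ℝ), U = 0 → δ ∈ Set.Ioo (0 : ℝ) (1 / 2) →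
      ¬ (∃ c : ℝ, 0 < c ∧ ∃ D L₀ : ℕ, ∀ L ≥ L₀, Even L → ∀ Hm, Hm = Literature.MathematicalPhysics.QuantumLattice.hubbardTorus 2 L 1 U → ∀ V : Submodule ℂ (Literature.MathematicalPhysics.QuantumLattice.Fock (Literature.MathematicalPhysics.QuantumLattice.Orb (Literature.MathematicalPhysics.QuantumLattice.FermionTorus 2 L))), V ≤ Literature.MathematicalPhysics.QuantumLattice.szSector (2 * ⌊(1 - δ) * (L : ℝ) ^ 2 / 2⌋₊) 0 → (∀ φ ∈ V, (star φ ⬝ᵥ Matrix.mulVec Hm φ).re ≤ (Matrix.minEnergyOn Hm (Literature.MathematicalPhysics.QuantumLattice.szSector (2 * ⌊(1 - δ) * (L : ℝ) ^ 2 / 2⌋₊) 0) + c / (L : ℝ)) * (star φ ⬝ᵥ φ).re) → Module.finrank ℂ V ≤ D) := by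
  rintro U δ rfl hδ ⟨c, hc, D, L₀, h⟩
  obtain ⟨L, hL, hLe, V, hV, hray, hdim⟩ := exists_lowLying_free hδ hc D L₀
  have hle := h L hL hLe _ rfl V hV hray
  omega

end Summit.HubbardSuperconductivity.HubbardSuperconductivity.Theorems.ParityGapRigidityFree

end
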